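import Summits.QuantumFields.YangMills.Theses.PlaquetteGasZeros
import HarnessLib

/-!
# Route `PlaquetteGasZeros` (planner ym-idea-11 g9, LINE 2, lens «wuc»), support V `VietaExtraction` (stmt-QuantumFields-23420) — BY NAME

`ZeroFreePolydisc → MomentBounds6LargeFac` (the verbatim hypothesis of `ThermodynamicCeilings.LargeVolumeCalibration`), with
`κ := τ` and `C := 2^{1+τ}/c` (rev 1 of Z1: n-tolerant radius `c·R⁴/(n+1)^τ`).

* §1 ★ `norm_coeff_le_of_zeroFree` — the MULTI-AFFINE VIETA BOUND (generic, any finite variable set `s`): if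
  `P(z) = Σ_{J ⊆ s} a_J z^J` has `a_∅ = 1` and no zero on the closed polydisc `‖z_i‖ ≤ ρ` (`i ∈ s`), then
  `‖a_s‖ ≤ 2^{#s}/ρ^{#s}`.  Proof by `Finset` induction, `s ↦ insert k s`: evaluating at the point supported on `{k}` gives
  `1 + w·a_{k} ≠ 0` for `|w| ≤ ρ`, hence `‖a_{k}‖ ≤ 1/ρ`; for fixed `|w| ≤ ρ` the normalised slice
  `b_J := (a_J + w·a_{J∪{k}})/(1 + w·a_{k})` has `b_∅ = 1` and is zero-free on the `s`-polydisc (update the `k`-th variable to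
  `w`), so the induction hypothesis gives `‖a_s + w·a_{s∪{k}}‖ ≤ 2·2^{#s}/ρ^{#s}`; the choices `w = ±ρ` and the triangle
  inequality give `2ρ‖a_{s∪{k}}‖ ≤ 4·2^{#s}/ρ^{#s}`.  (Sharper than the card's Bell-number recurrence; no alignment argument.)
* §2 ★ `plaquetteGasZeros_vietaExtraction_proof` — the item: apply §1 to `a_J := E_{β,L} ∏_{i∈J}(plane(qᵢ,xᵢ) − E plane(qᵢ,xᵢ))`
  (`a_∅ = E 1 = 1`, `a_univ` = the full centred moment) on the polydisc of radius `ρ = c·R⁴/(n+1)^τ` supplied by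
  `ZeroFreePolydisc` (rev 1, n-tolerant): `|E ∏ᵢ(plane − E plane)| ≤ (2(n+1)^τ/(cR⁴))ⁿ ≤ (C·n^τ/R⁴)ⁿ` with `C = 2·2^τ/c`
  (`(n+1)^τ ≤ (2n)^τ` for `n ≥ 1`; `n = 0` trivial); the witnesses `(ℓ₄, β₄, L₀)` are Z1's.

Width seat ym-line-sfw-p2-w2 g23 (cell ym-idea-1; free hands).  HONEST FRAMING: `ZeroFreePolydisc` (Z1, the Lee–Yang/Dobrushin zero-free
polydisc of the plaquette gas — open-problem) and `FloorsC` stay OPEN; this closes only the support V; no crux, rung (R2a is a RECORD rung)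
or summit is proved and the Yang–Mills mass gap is NOT proved. [cite: Ruelle1969, §4.2]
-/

set_option autoImplicit false

noncomputable section

open scoped BigOperators
open MeasureTheory
open Literature.MathematicalPhysics.QuantumFieldTheory Literature.MathematicalPhysics.QuantumLattice
open Summit.QuantumFields.YangMills.Cruxes.OSLegsFromFemtoAndGap.DlrCollarTransfer (torusE plane)

namespace Summit.QuantumFields.YangMills.Theorems.PlaquetteGasZeros

/-! ## §1 The multi-affine Vieta bound -/

/-- ★ **Multi-affine Vieta bound.**  Let `a : Finset ι → ℂ` with `a ∅ = 1`, `ρ > 0`, and suppose the multi-affine polynomial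
`P(z) = Σ_{J ⊆ s} (∏_{i∈J} zᵢ)·a_J` has no zero on the closed polydisc `{‖zᵢ‖ ≤ ρ, i ∈ s}`.  Then the top coefficient obeys
`‖a_s‖ ≤ 2^{#s} / ρ^{#s}`. [cite: Ruelle1969, §4.2] -/
theorem norm_coeff_le_of_zeroFree {ι : Type*} [DecidableEq ι] (s : Finset ι) :
    ∀ (a : Finset ι → ℂ) {ρ : ℝ}, 0 < ρ → a ∅ = 1 →
      (∀ z : ι → ℂ, (∀ i ∈ s, ‖z i‖ ≤ ρ) → ∑ J ∈ s.powerset, (∏ i ∈ J, z i) * a J ≠ 0) →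
      ‖a s‖ ≤ 2 ^ s.card / ρ ^ s.card := by
  induction s using Finset.induction_on with
  | empty =>
    intro a ρ _ ha0 _
    simp [ha0]
  | @insert k s hk ih =>
    intro a ρ hρ ha0 hz
    -- evaluation at the point supported on `{k}`
    have hsingle : ∀ w : ℂ,
        ∑ J ∈ (insert k s).powerset, (∏ i ∈ J, (if i = k then w else (0 : ℂ))) * a J = 1 + w * a {k} := by
      intro w
      rw [Finset.sum_powerset_insert hk]
      have h1 : ∑ J ∈ s.powerset, (∏ i ∈ J, (if i = k then w else (0 : ℂ))) * a J = 1 := by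
        rw [Finset.sum_eq_single_of_mem ∅ (Finset.empty_mem_powerset s)]
        · simp [ha0]
        · intro J hJ hne
          obtain ⟨i, hi⟩ := Finset.nonempty_iff_ne_empty.mpr hne
          have hik : i ≠ k := fun h => hk (h ▸ (Finset.mem_powerset.mp hJ hi))
          rw [Finset.prod_eq_zero hi (by simp [hik]), zero_mul]
      have h2 : ∑ J ∈ s.powerset, (∏ i ∈ insert k J, (if i = k then w else (0 : ℂ))) * a (insert k J) =
          w * a {k} := by
        rw [Finset.sum_eq_single_of_mem ∅ (Finset.empty_mem_powerset s)]
        · simp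
        · intro J hJ hne
          obtain ⟨i, hi⟩ := Finset.nonempty_iff_ne_empty.mpr hne
          have hik : i ≠ k := fun h => hk (h ▸ (Finset.mem_powerset.mp hJ hi))
          rw [Finset.prod_eq_zero (Finset.mem_insert_of_mem hi) (by simp [hik]), zero_mul]
      rw [h1, h2]
    have hc : ∀ w : ℂ, ‖w‖ ≤ ρ → 1 + w * a {k} ≠ 0 := by
      intro w hw
      rw [← hsingle w]
      refine hz _ fun i _ => ?_
      by_cases h : i = k
      · simp [h, hw]
      · simp [h, hρ.le]
    -- the one-variable bound `‖a_{k}‖ ≤ 1/ρ`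
    have hk1 : ‖a {k}‖ ≤ ρ⁻¹ := by
      by_contra hle
      have hlt := not_le.mp hle
      have hane : a {k} ≠ 0 := by
        intro h0
        rw [h0, norm_zero] at hlt
        exact lt_irrefl _ (hlt.trans (inv_pos.mpr hρ))
      have hw : ‖-(a {k})⁻¹‖ ≤ ρ := by
        rw [norm_neg, norm_inv]
        exact (inv_le_comm₀ (norm_pos_iff.mpr hane) hρ).mpr hlt.le
      refine hc _ hw ?_
      rw [neg_mul, inv_mul_cancel₀ hane]; ring
    -- one slice: for `‖w‖ ≤ ρ`, `‖a_s + w a_{s ∪ {k}}‖ ≤ 2 · 2^{#s}/ρ^{#s}`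
    have hstep : ∀ w : ℂ, ‖w‖ ≤ ρ → ‖a s + w * a (insert k s)‖ ≤ 2 ^ s.card / ρ ^ s.card * 2 := by
      intro w hw
      set c : ℂ := 1 + w * a {k} with hcdef
      have hc0 : c ≠ 0 := hc w hw
      have hcn : ‖c‖ ≤ 2 := by
        calc ‖c‖ ≤ ‖(1 : ℂ)‖ + ‖w * a {k}‖ := norm_add_le _ _
          _ ≤ 1 + ρ * ρ⁻¹ := by
              rw [norm_one, norm_mul]
              exact add_le_add le_rfl (mul_le_mul hw hk1 (norm_nonneg _) hρ.le)
          _ = 2 := by rw [mul_inv_cancel₀ hρ.ne']; norm_num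
      set b : Finset ι → ℂ := fun J => (a J + w * a (insert k J)) / c with hbdef
      have hb0 : b ∅ = 1 := by
        have hins : insert k (∅ : Finset ι) = {k} := by ext; simp
        have : a ∅ + w * a (insert k ∅) = c := by rw [ha0, hcdef, hins]
        simp only [hbdef, this, div_self hc0]
      have hbz : ∀ z' : ι → ℂ, (∀ i ∈ s, ‖z' i‖ ≤ ρ) → ∑ J ∈ s.powerset, (∏ i ∈ J, z' i) * b J ≠ 0 := by
        intro z' hz'
        set z : ι → ℂ := Function.update z' k w with hzdef
        have hzk : z k = w := by rw [hzdef, Function.update_self]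
        have hzi : ∀ i, i ≠ k → z i = z' i := fun i hi => by rw [hzdef, Function.update_of_ne hi]
        have hprodJ : ∀ J ∈ s.powerset, ∏ i ∈ J, z i = ∏ i ∈ J, z' i := by
          intro J hJ
          refine Finset.prod_congr rfl fun i hi => hzi i ?_
          exact fun h => hk (h ▸ Finset.mem_powerset.mp hJ hi)
        have hprodIns : ∀ J ∈ s.powerset, ∏ i ∈ insert k J, z i = w * ∏ i ∈ J, z' i := by
          intro J hJ
          have hkJ : k ∉ J := fun h => hk (Finset.mem_powerset.mp hJ h)
          rw [Finset.prod_insert hkJ, hzk, hprodJ J hJ]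
        have hsum : ∑ J ∈ (insert k s).powerset, (∏ i ∈ J, z i) * a J =
            c * ∑ J ∈ s.powerset, (∏ i ∈ J, z' i) * b J := by
          rw [Finset.sum_powerset_insert hk, Finset.mul_sum, ← Finset.sum_add_distrib]
          refine Finset.sum_congr rfl fun J hJ => ?_
          rw [hprodJ J hJ, hprodIns J hJ]
          have e : b J * c = a J + w * a (insert k J) := by
            simp only [hbdef]; exact div_mul_cancel₀ _ hc0
          calc (∏ i ∈ J, z' i) * a J + w * (∏ i ∈ J, z' i) * a (insert k J)
              = (∏ i ∈ J, z' i) * (a J + w * a (insert k J)) := by ring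
            _ = (∏ i ∈ J, z' i) * (b J * c) := by rw [e]
            _ = c * ((∏ i ∈ J, z' i) * b J) := by ring
        have hne : ∑ J ∈ (insert k s).powerset, (∏ i ∈ J, z i) * a J ≠ 0 := by
          refine hz z fun i hi => ?_
          rcases Finset.mem_insert.mp hi with rfl | hi'
          · rw [hzk]; exact hw
          · rw [hzi i (fun h => hk (h ▸ hi'))]; exact hz' i hi'
        rw [hsum] at hne
        exact right_ne_zero_of_mul hne
      have hIH := ih b hρ hb0 hbz
      have hnorm : ‖a s + w * a (insert k s)‖ = ‖b s‖ * ‖c‖ := by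
        have e : a s + w * a (insert k s) = b s * c := by
          simp only [hbdef]; exact (div_mul_cancel₀ _ hc0).symm
        rw [e, norm_mul]
      rw [hnorm]
      exact mul_le_mul hIH hcn (norm_nonneg _) (by positivity)
    -- the two slices `w = ±ρ`
    have hnρ : ‖((ρ : ℝ) : ℂ)‖ ≤ ρ := by rw [Complex.norm_real, Real.norm_of_nonneg hρ.le]
    have hp := hstep (ρ : ℂ) hnρ
    have hm := hstep (-(ρ : ℂ)) (by rwa [norm_neg])
    have h2ρ : ‖(2 * (ρ : ℂ)) * a (insert k s)‖ ≤ 2 ^ s.card / ρ ^ s.card * 2 + 2 ^ s.card / ρ ^ s.card * 2 := by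
      have e : (2 * (ρ : ℂ)) * a (insert k s) =
          (a s + (ρ : ℂ) * a (insert k s)) - (a s + (-(ρ : ℂ)) * a (insert k s)) := by ring
      rw [e]
      exact (norm_sub_le _ _).trans (add_le_add hp hm)
    have hn2 : ‖(2 * (ρ : ℂ))‖ = 2 * ρ := by
      rw [norm_mul, Complex.norm_real, Real.norm_of_nonneg hρ.le]
      norm_num
    rw [norm_mul, hn2] at h2ρ
    have hρs : 0 < ρ ^ s.card := by positivity
    have h3 : ‖a (insert k s)‖ * ρ ≤ 2 ^ s.card / ρ ^ s.card * 2 := by nlinarith [h2ρ, norm_nonneg (a (insert k s))]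
    rw [Finset.card_insert_of_notMem hk, pow_succ, pow_succ, le_div_iff₀ (by positivity)]
    calc ‖a (insert k s)‖ * (ρ ^ s.card * ρ) = (‖a (insert k s)‖ * ρ) * ρ ^ s.card := by ring
      _ ≤ (2 ^ s.card / ρ ^ s.card * 2) * ρ ^ s.card := mul_le_mul_of_nonneg_right h3 hρs.le
      _ = 2 ^ s.card * 2 := by field_simp

/-! ## §2 The item -/

/-- ★ **`PlaquetteGasZeros.VietaExtraction`** (item stmt-QuantumFields-23420) BY NAME: the zero-free polydisc of radius `c·R⁴` for the
plaquette-gas polynomial `Σ_J (∏_{i∈J} zᵢ)·E∏_{i∈J}(plane(qᵢ,xᵢ) − E plane)` (constant term `E 1 = 1`; rev-1 radius `c·R⁴/(n+1)^τ`)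
gives, by the multi-affine Vieta bound, the large-volume factorial ceilings `|E ∏ᵢ(plane − E plane)| ≤ (C·n^κ/R⁴)ⁿ` with
`κ = τ`, `C = 2·2^τ/c` and Z1's witnesses `(ℓ₄, β₄, L₀)`. [cite: Ruelle1969, §4.2] -/
theorem plaquetteGasZeros_vietaExtraction_proof :
    Summit.QuantumFields.YangMills.Theses.PlaquetteGasZeros.VietaExtraction := by
  intro hZ G _ _ _ _ hG hSU
  letI : MeasurableSpace G := borel G
  haveI : BorelSpace G := ⟨rfl⟩
  intro r v f g h Λ₅
  obtain ⟨ε₀, hε₀, hZ'⟩ := hZ G hG hSU r v f g h Λ₅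
  refine ⟨ε₀, hε₀, fun ε hε hεle hfl => ?_⟩
  obtain ⟨c, τ, ℓ₄, β₄, hc, hτ, hℓ₄, hmain⟩ := hZ' ε hε hεle hfl
  refine ⟨2 * (2 : ℝ) ^ τ / c, τ, ℓ₄, β₄, hℓ₄, by positivity, hτ, fun β hβ => ?_⟩
  obtain ⟨L₀, hL₀⟩ := hmain β hβ
  refine ⟨L₀, fun s hs hs1 hnofloor L n q x R hq hR hRs hRL hL0L hsep => ?_⟩
  set ρ : ℝ := c * (R : ℝ) ^ 4 / ((n : ℝ) + 1) ^ τ with hρ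
  have hpoly : ∀ z : Fin n → ℂ, (∀ i, ‖z i‖ ≤ ρ) →
      ∑ J ∈ (Finset.univ : Finset (Fin n)).powerset, (∏ i ∈ J, z i) *
        ((torusE G r β L (fun U => ∏ i ∈ J, (plane G r (q i) (x i) U - torusE G r β L (plane G r (q i) (x i)))) : ℝ) : ℂ)
          ≠ 0 :=
    fun z hz => hL₀ s hs hs1 hnofloor L n q x R z hq hR hRs hRL hL0L hsep hz
  have hR0 : (0 : ℝ) < R := by exact_mod_cast hR
  have hn1τ : 0 < ((n : ℝ) + 1) ^ τ := Real.rpow_pos_of_pos (by positivity) τ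
  have hρ0 : 0 < ρ := by rw [hρ]; positivity
  set a : Finset (Fin n) → ℂ := fun J =>
    ((torusE G r β L (fun U => ∏ i ∈ J, (plane G r (q i) (x i) U - torusE G r β L (plane G r (q i) (x i)))) : ℝ) : ℂ)
    with ha
  have hE1 : torusE G r β L (fun _ => (1 : ℝ)) = 1 := by
    haveI := isProbabilityMeasure_wilsonMeasure (d := 4) (L := 2 * L + 1) r.ρ r.continuous β
    simp [torusE]
  have ha0 : a ∅ = 1 := by
    simp only [ha, Finset.prod_empty, hE1, Complex.ofReal_one]
  have hzf : ∀ z : Fin n → ℂ, (∀ i ∈ (Finset.univ : Finset (Fin n)), ‖z i‖ ≤ ρ) →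
      ∑ J ∈ (Finset.univ : Finset (Fin n)).powerset, (∏ i ∈ J, z i) * a J ≠ 0 :=
    fun z hz => hpoly z fun i => hz i (Finset.mem_univ i)
  have hV := norm_coeff_le_of_zeroFree Finset.univ a hρ0 ha0 hzf
  rw [Finset.card_univ, Fintype.card_fin] at hV
  have hEq : ‖a Finset.univ‖ =
      |torusE G r β L (fun U => ∏ i, (plane G r (q i) (x i) U - torusE G r β L (plane G r (q i) (x i))))| := by
    simp only [ha, Complex.norm_real, Real.norm_eq_abs]
  rw [hEq] at hV
  refine hV.trans ?_
  rw [← div_pow]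
  rcases Nat.eq_zero_or_pos n with hn0 | hnpos
  · subst hn0; simp
  · apply pow_le_pow_left₀ (by positivity)
    have hn1 : (1 : ℝ) ≤ n := by exact_mod_cast hnpos
    have hτn : ((n : ℝ) + 1) ^ τ ≤ (2 : ℝ) ^ τ * (n : ℝ) ^ τ := by
      rw [← Real.mul_rpow (by norm_num) (by positivity)]
      exact Real.rpow_le_rpow (by positivity) (by linarith) hτ
    have hcR : 0 < c * (R : ℝ) ^ 4 := by positivity
    calc 2 / ρ = 2 * ((n : ℝ) + 1) ^ τ / (c * (R : ℝ) ^ 4) := by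
          rw [hρ]; field_simp
      _ ≤ 2 * ((2 : ℝ) ^ τ * (n : ℝ) ^ τ) / (c * (R : ℝ) ^ 4) := by gcongr
      _ = 2 * (2 : ℝ) ^ τ / c * (n : ℝ) ^ τ / (R : ℝ) ^ 4 := by
          field_simp

end Summit.QuantumFields.YangMills.Theorems.PlaquetteGasZeros

end
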